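import Literature.AlgebraicGeometry.Motives.GrassmannianSheaf
import Literature.AlgebraicGeometry.Motives.GrassmannianChartUniversalProperty
import HarnessLib

/-!
# The standard charts of the Grassmannian SCHEME (objects): `chartScheme I = Spec ℤ[X_{j i}]`, `chartElem`, `chartMap`

Topic `Literature/AlgebraicGeometry/Motives`; namespace `Literature.AlgebraicGeometry.Motives.Grassmannian`.  Cell hodgecm-mathlib key
(h4) «the Grassmannian functor is representable», DESIGN D (B-p21 (g15)) and the (A3)/(A4) INTERFACE MEMO (`A34-INTERFACE.B-p21g15.md`):
(A3.1) `chartScheme`, (A3.2) `chartElem` / `chartMap` (B-p18 (g17)).  DEFINITIONS + `rfl` lemmas only (statement-only lane); their theory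
— (A3.3) `chartMap_app_injective`, (A3.6) `exists_mem_range_chartMap_app_of_field`, the affine computation `specEquiv_map_chartElem` —
is the PROOF-lane sequel `GrassmannianChartSchemeRange`.  No instance / notation / `sorry`.

Data: `M : Type u` an abelian group with a `ℤ`-basis `b : J → M` (`J : Type u`, e.g. `Module.Free.ChooseBasisIndex ℤ M`), `k : ℕ`, a
chart index `I : Fin k → J` (injective); `σ_I := {j // j ∉ range I}`.

* (A3.1) `chartRing k I := ℤ[X_p : p ∈ σ_I × Fin k]` (a `CommRingCat.{u}`; variables in `Type u`, so plain `ℤ` coefficients keep it in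
  `Type u`; a `def`, so its `ℤ`-algebra structure is the canonical `algebraInt`), `chartScheme k I := Spec (chartRing k I)` (an `abbrev`),
  `chartVar` (the variables), `chartRingHom v` (evaluation `X_p ↦ v p`);
* (A3.2) `chartCoordMap` (free columns = the variables, ★ `coordMapOfColumns`), `chartElemAffine := ofCoordMap (b ∘ I) chartCoordMap`
  (the universal chart point in `G(k, ℤ[X] ⊗ M; ℤ[X])`), **`chartElem := specEquiv⁻¹ chartElemAffine ∈ Gr(chartScheme)`** and
  **`chartMap := yonedaEquiv.symm chartElem : yoneda.obj (chartScheme k I) ⟶ Gr`**, with `chartMap_app_apply` (`rfl`).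

[Stacks 089T] (the `U_I ≅ 𝔸^{k(n−k)}` cover `G(k,n)`); EGA I (1971) 9.7.4; [EisenbudHarris2016, §3.2.2]; [GortzWedhorn2020, (8.4)–(8.6)].
HC_CM is proved only modulo the 7 printed citations until rung 0 closes; nothing here is about HC.
-/

noncomputable section

namespace Literature.AlgebraicGeometry.Motives.Grassmannian

open CategoryTheory Opposite TensorProduct _root_.AlgebraicGeometry

universe u

/-! ## §1 (A3.1) The chart scheme `Spec ℤ[X_{j i}]` -/

section ChartScheme

variable (k : ℕ) {J : Type u}

/-- **The coordinate ring of the chart `U_I`**: the polynomial ring `ℤ[X_p : p ∈ {j // j ∉ range I} × Fin k]` as a bundled commutative ring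
(a `def`, so that the `ℤ`-algebra structure on its carrier is the canonical `algebraInt`). [cite: StacksProject, Tag 089T] -/
def chartRing (I : Fin k → J) : CommRingCat.{u} :=
  CommRingCat.of (MvPolynomial ({j : J // j ∉ Set.range I} × Fin k) ℤ)

/-- **The chart scheme `𝔸^{k · #(J ∖ I)} = Spec ℤ[X_p]`.** [cite: StacksProject, Tag 089T] -/
abbrev chartScheme (I : Fin k → J) : Scheme.{u} :=
  Spec (chartRing k I)

/-- The coordinate functions `X_p ∈ ℤ[X]` of the chart. [cite: StacksProject, Tag 089T] -/
def chartVar (I : Fin k → J) (p : {j : J // j ∉ Set.range I} × Fin k) : chartRing k I :=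
  (MvPolynomial.X p : MvPolynomial ({j : J // j ∉ Set.range I} × Fin k) ℤ)

/-- **Evaluation**: the ring map `ℤ[X_p] → A`, `X_p ↦ v p`. [cite: StacksProject, Tag 089T] -/
def chartRingHom (I : Fin k → J) {A : CommRingCat.{u}} (v : {j : J // j ∉ Set.range I} × Fin k → A) : chartRing k I ⟶ A :=
  CommRingCat.ofHom (MvPolynomial.eval₂Hom (Int.castRingHom A) v)

end ChartScheme

/-! ## §2 (A3.2) The universal chart element and the chart map -/

section ChartMap

variable (k : ℕ) (M : Type u) [AddCommGroup M] {J : Type u} (b : Module.Basis J ℤ M)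

/-- **The universal coordinate map of the chart `U_I`**: `M → ℤ[X]ᵏ`, `b_{I i} ↦ eᵢ`, `b_j ↦ (X_{(j,i)})_i` for `j ∉ range I`
(★ `coordMapOfColumns` with the variables as free columns). [cite: StacksProject, Tag 089T] [cite: EisenbudHarris2016, §3.2.2] -/
def chartCoordMap (I : Fin k → J) : M →ₗ[ℤ] (Fin k → chartRing k I) :=
  coordMapOfColumns b I fun j i => chartVar k I (j, i)

/-- **The universal chart point, affine form**: `N_univ := ker (chartCoordMap ⊗ ℤ[X]) ∈ G(k, ℤ[X] ⊗ M; ℤ[X])` (★ `ofCoordMap`; the frame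
normalisation is ★ `coordMapOfColumns_frame`, `I` injective). [cite: StacksProject, Tag 089T] -/
def chartElemAffine (I : Fin k → J) (hI : Function.Injective I) :
    Module.Grassmannian (chartRing k I) (chartRing k I ⊗[ℤ] M) k :=
  ofCoordMap (⇑b ∘ I) (chartCoordMap k M b I) (coordMapOfColumns_frame b I hI _)

/-- **The universal chart element** `chartElem ∈ Gr(chartScheme)`: the affine universal point read through B-p21's
`specEquiv : Gr(Spec A) ≃ G(k, A ⊗ M; A)`. [cite: StacksProject, Tag 089T] -/
def chartElem (I : Fin k → J) (hI : Function.Injective I) : (grassmannianSheaf M k).obj.obj (op (chartScheme k I)) :=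
  (specEquiv M k (chartRing k I)).symm (chartElemAffine k M b I hI)

/-- **THE CHART MAP `f_I : yoneda(chartScheme I) ⟶ Gr`** — the Yoneda morphism of the universal chart element: a `T`-point
`g : T ⟶ Spec ℤ[X]` goes to `g^* chartElem ∈ Gr(T)`. [cite: StacksProject, Tag 089T] -/
def chartMap (I : Fin k → J) (hI : Function.Injective I) : yoneda.obj (chartScheme k I) ⟶ (grassmannianSheaf M k).obj :=
  yonedaEquiv.symm (chartElem k M b I hI)

/-- The chart map on `T`-points: `g ↦ Gr(g) chartElem`. [cite: StacksProject, Tag 089T] -/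
theorem chartMap_app_apply (I : Fin k → J) (hI : Function.Injective I) {T : Scheme.{u}} (g : T ⟶ chartScheme k I) :
    (chartMap k M b I hI).app (op T) g = (grassmannianSheaf M k).obj.map g.op (chartElem k M b I hI) :=
  rfl

end ChartMap

end Literature.AlgebraicGeometry.Motives.Grassmannian

end
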